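import Summits.BirchSwinnertonDyer.BirchSwinnertonDyer.Theorems.ResidualThetaTransportAtTwoResidualSignedLambdaLowerCMAtTwoColemanPlusKernelTwoCoeff
import HarnessLib

/-!
# `Col⁺ ⊗ 𝒪` at `p = 2` as a MAP: the plus Coleman value is unique, hence an `𝒪`-linear surjection
# `Hom(E(ℚ_{2,∞}·ℚ_v), 𝒪) ↠ Λ_𝒪` with kernel `ann(E⁺_∞)` (STUB-PLAN rev 7 stub 1 / U7 «VS pins 𝒸», functional model)

Route `ResidualThetaTransportAtTwo` (RTT), crux RSL_g `ResidualSignedLambdaLowerCMAtTwo` (stmt-BirchSwinnertonDyer-22608; the (R≥)ᵖ crux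
stmt-BirchSwinnertonDyer-26074 is glue above it), DAG node N1 ⊗ 𝒪. Seat `prover-bsd-wall-rtt-p2` g16 (`--supports`, closes nothing). Sequel of
`…ColemanPlusKernelTwoCoeff` (p662174: existence / onto / kernel of plus Coleman VALUES). THEOREMS ONLY (no definition, no named fact, no
instance, no `sorry`); BSD is not proved by any of this; 22608 / 26074 OPEN.

WHAT. `colemanPlus_coeff_two` says: every `𝒪`-valued functional `z` on the tower points HAS a plus value `L` (congruences
`ω_{2m} ∣ P_{2m}(z) + (−1)^m ω̃⁻_{2m} L`), every `L` occurs, and for ANY pair `(z, L)` satisfying the congruences `L = 0 ↔ z` kills `E⁺_∞`.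
Applied to the pair `(0, L − L')` the kernel clause gives UNIQUENESS of the value; the congruence system is `𝒪`-linear in `(z, L)`; so the
value is an `𝒪`-LINEAR MAP.
* §1 (generic congruence systems `∀ m, Ω_m ∣ Σ_{j<N_m} C(z(pt m j))(X+1)^j + ε_m Ω'_m L`): `plusCongr_add`, `plusCongr_smul`, `plusCongr_zero_sub`,
  **`plusCongr_unique`**, **`exists_linearMap_of_plusCongr`** (existence + kernel-criterion ⇒ a linear map pinned by the congruences, onto if every
  value occurs, with the kernel characterisation).
* §2 **`exists_colemanPlusHom_coeff_two`** — for `W/ℚ` globally minimal, `GoodSS W 2`, `a₂ = 0`, cyclotomic `κ`, `v ∋ 2`: the plus Honda family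
  `(g, d)` of `colemanPlus_coeff_two` and, for every `𝒪` finite free over `ℤ₂` and a domain, an `𝒪`-linear
  `col : (E(ℚ_{2,∞}·ℚ_v) →+ 𝒪) →ₗ[𝒪] 𝒪⟦T⟧`, SURJECTIVE, PINNED by the congruences (any plus value of `z` equals `col z`), with
  `col z = 0 ↔ z` vanishes on every `E⁺(ℚ_{2,n}·ℚ_v)` — i.e. `Hom(E(ℚ_{2,∞}·ℚ_v), 𝒪)/ann(E⁺_∞) ≅ Λ_𝒪` as `𝒪`-modules through ONE named map
  (the `𝒸` of STUB-PLAN rev 7 §3.2′ is `col ∘ loc₂`; its «VS» is the congruence clause, and U7 = `plusCongr_unique`).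

References: [Kobayashi2003] Thm. 6.2, Prop. 8.12, 8.18–8.23; [Sprung2012] Thm. 2.2 (2′), Def. 5.9, Prop. 7.3; [Sprung2017] Cor. 4.4.
-/

set_option autoImplicit false
-- the Theorems namespace of this sub repeats the summit name by design (D-0017 nested layout)
set_option linter.dupNamespace false

noncomputable section

open scoped Classical
open Polynomial Finset

namespace Summit.BirchSwinnertonDyer.BirchSwinnertonDyer.Theorems.SignedColemanImage

open Literature.NumberTheory.EllipticCurves Literature.NumberTheory.EllipticCurves.Kobayashi2003 Function

universe u

/-! ## §1 Generic congruence systems: linearity and uniqueness of the value -/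

section Generic

variable {M : Type*} [AddCommGroup M] {O : Type*} [CommRing O]
  (pt : ℕ → ℕ → M) (N : ℕ → ℕ) (Ω Ω' : ℕ → PowerSeries O) (ε : ℕ → PowerSeries O)

/-- The orbit sum `Σ_{j<N_m} C(z(pt m j))(X+1)^j` is additive in the functional. [folklore] -/
theorem orbitPoly_add (z z' : M →+ O) (m : ℕ) :
    ((∑ j ∈ range (N m), C ((z + z') (pt m j)) * (X + 1) ^ j : O[X]) : PowerSeries O) =
      ((∑ j ∈ range (N m), C (z (pt m j)) * (X + 1) ^ j : O[X]) : PowerSeries O) +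
        ((∑ j ∈ range (N m), C (z' (pt m j)) * (X + 1) ^ j : O[X]) : PowerSeries O) := by
  rw [← Polynomial.coe_add, ← Finset.sum_add_distrib]
  congr 1
  exact Finset.sum_congr rfl fun j _ ↦ by rw [AddMonoidHom.add_apply, map_add, add_mul]

/-- The orbit sum is `𝒪`-homogeneous in the functional: `P(a•z) = C a · P(z)`. [folklore] -/
theorem orbitPoly_smul (a : O) (z : M →+ O) (m : ℕ) :
    ((∑ j ∈ range (N m), C ((a • z) (pt m j)) * (X + 1) ^ j : O[X]) : PowerSeries O) =
      PowerSeries.C a * ((∑ j ∈ range (N m), C (z (pt m j)) * (X + 1) ^ j : O[X]) : PowerSeries O) := by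
  rw [← Polynomial.coe_C, ← Polynomial.coe_mul, Finset.mul_sum]
  congr 1
  exact Finset.sum_congr rfl fun j _ ↦ by rw [AddMonoidHom.smul_apply, smul_eq_mul, map_mul, mul_assoc]

/-- The orbit sum of the zero functional vanishes. [folklore] -/
theorem orbitPoly_zero (m : ℕ) :
    ((∑ j ∈ range (N m), C ((0 : M →+ O) (pt m j)) * (X + 1) ^ j : O[X]) : PowerSeries O) = 0 := by
  rw [Finset.sum_eq_zero fun j _ ↦ by rw [AddMonoidHom.zero_apply, map_zero, zero_mul], Polynomial.coe_zero]

/-- **Additivity of the congruence system**: plus values add. [cite: Kobayashi2003, Prop. 8.12 (p. 19)] -/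
theorem plusCongr_add {z z' : M →+ O} {L L' : PowerSeries O}
    (h : ∀ m, Ω m ∣ ((∑ j ∈ range (N m), C (z (pt m j)) * (X + 1) ^ j : O[X]) : PowerSeries O) + ε m * Ω' m * L)
    (h' : ∀ m, Ω m ∣ ((∑ j ∈ range (N m), C (z' (pt m j)) * (X + 1) ^ j : O[X]) : PowerSeries O) + ε m * Ω' m * L') :
    ∀ m, Ω m ∣ ((∑ j ∈ range (N m), C ((z + z') (pt m j)) * (X + 1) ^ j : O[X]) : PowerSeries O) + ε m * Ω' m * (L + L') := by
  intro m
  rw [orbitPoly_add]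
  have := dvd_add (h m) (h' m)
  convert this using 1
  ring

/-- **Homogeneity of the congruence system**: the plus value of `a•z` is `C a · L`. [cite: Kobayashi2003, Prop. 8.12 (p. 19)] -/
theorem plusCongr_smul (a : O) {z : M →+ O} {L : PowerSeries O}
    (h : ∀ m, Ω m ∣ ((∑ j ∈ range (N m), C (z (pt m j)) * (X + 1) ^ j : O[X]) : PowerSeries O) + ε m * Ω' m * L) :
    ∀ m, Ω m ∣ ((∑ j ∈ range (N m), C ((a • z) (pt m j)) * (X + 1) ^ j : O[X]) : PowerSeries O) +
      ε m * Ω' m * (PowerSeries.C a * L) := by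
  intro m
  rw [orbitPoly_smul]
  have := Dvd.dvd.mul_left (h m) (PowerSeries.C a)
  convert this using 1
  ring

/-- Two plus values of the same functional differ by a plus value of the ZERO functional. [folklore] -/
theorem plusCongr_zero_sub {z : M →+ O} {L L' : PowerSeries O}
    (h : ∀ m, Ω m ∣ ((∑ j ∈ range (N m), C (z (pt m j)) * (X + 1) ^ j : O[X]) : PowerSeries O) + ε m * Ω' m * L)
    (h' : ∀ m, Ω m ∣ ((∑ j ∈ range (N m), C (z (pt m j)) * (X + 1) ^ j : O[X]) : PowerSeries O) + ε m * Ω' m * L') :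
    ∀ m, Ω m ∣ ((∑ j ∈ range (N m), C ((0 : M →+ O) (pt m j)) * (X + 1) ^ j : O[X]) : PowerSeries O) +
      ε m * Ω' m * (L - L') := by
  intro m
  rw [orbitPoly_zero, zero_add]
  have := dvd_sub (h m) (h' m)
  convert this using 1
  ring

/-- **UNIQUENESS of the plus value** (STUB-PLAN rev 7 U7 «VS pins 𝒸»): if the congruence system has the KERNEL property «for every pair
`(z, L)` satisfying it, `L = 0 ↔ Kills z`» for a predicate with `Kills 0`, then a functional has at most one plus value.
[cite: Kobayashi2003, Thm. 6.2 (p. 12)] [cite: Sprung2012, Prop. 7.3] -/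
theorem plusCongr_unique (Kills : (M →+ O) → Prop) (hK0 : Kills 0)
    (hker : ∀ (z : M →+ O) (L : PowerSeries O),
      (∀ m, Ω m ∣ ((∑ j ∈ range (N m), C (z (pt m j)) * (X + 1) ^ j : O[X]) : PowerSeries O) + ε m * Ω' m * L) → (L = 0 ↔ Kills z))
    {z : M →+ O} {L L' : PowerSeries O}
    (h : ∀ m, Ω m ∣ ((∑ j ∈ range (N m), C (z (pt m j)) * (X + 1) ^ j : O[X]) : PowerSeries O) + ε m * Ω' m * L)
    (h' : ∀ m, Ω m ∣ ((∑ j ∈ range (N m), C (z (pt m j)) * (X + 1) ^ j : O[X]) : PowerSeries O) + ε m * Ω' m * L') :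
    L = L' :=
  sub_eq_zero.mp (((hker 0 (L - L') (plusCongr_zero_sub pt N Ω Ω' ε h h')).mpr hK0))

/-- **The plus value as a LINEAR MAP**: existence of a value for every functional + the kernel property ⇒ there is an `𝒪`-linear
`col : (M →+ 𝒪) → 𝒪⟦T⟧` PINNED by the congruences (every plus value of `z` is `col z`), with `col z = 0 ↔ Kills z`; if every series is a
value, `col` is onto. [cite: Kobayashi2003, Thm. 6.2 (p. 12)] [cite: Sprung2012, Thm. 2.2 (2′), Prop. 7.3] -/
theorem exists_linearMap_of_plusCongr (Kills : (M →+ O) → Prop) (hK0 : Kills 0)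
    (hex : ∀ z : M →+ O, ∃ L : PowerSeries O,
      ∀ m, Ω m ∣ ((∑ j ∈ range (N m), C (z (pt m j)) * (X + 1) ^ j : O[X]) : PowerSeries O) + ε m * Ω' m * L)
    (hker : ∀ (z : M →+ O) (L : PowerSeries O),
      (∀ m, Ω m ∣ ((∑ j ∈ range (N m), C (z (pt m j)) * (X + 1) ^ j : O[X]) : PowerSeries O) + ε m * Ω' m * L) → (L = 0 ↔ Kills z)) :
    ∃ col : (M →+ O) →ₗ[O] PowerSeries O,
      (∀ z m, Ω m ∣ ((∑ j ∈ range (N m), C (z (pt m j)) * (X + 1) ^ j : O[X]) : PowerSeries O) + ε m * Ω' m * col z) ∧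
      (∀ (z : M →+ O) (L : PowerSeries O),
        (∀ m, Ω m ∣ ((∑ j ∈ range (N m), C (z (pt m j)) * (X + 1) ^ j : O[X]) : PowerSeries O) + ε m * Ω' m * L) → L = col z) ∧
      (∀ z, col z = 0 ↔ Kills z) ∧
      ((∀ F : PowerSeries O, ∃ z : M →+ O,
        ∀ m, Ω m ∣ ((∑ j ∈ range (N m), C (z (pt m j)) * (X + 1) ^ j : O[X]) : PowerSeries O) + ε m * Ω' m * F) →
        Surjective col) := by
  choose val hval using hex
  have huniq : ∀ (z : M →+ O) (L : PowerSeries O),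
      (∀ m, Ω m ∣ ((∑ j ∈ range (N m), C (z (pt m j)) * (X + 1) ^ j : O[X]) : PowerSeries O) + ε m * Ω' m * L) → L = val z :=
    fun z L hL ↦ plusCongr_unique pt N Ω Ω' ε Kills hK0 hker hL (hval z)
  refine ⟨{ toFun := val
            map_add' := fun z z' ↦ (huniq _ _ (plusCongr_add pt N Ω Ω' ε (hval z) (hval z'))).symm
            map_smul' := fun a z ↦ (huniq _ _ (by
              rw [RingHom.id_apply, PowerSeries.smul_eq_C_mul]
              exact plusCongr_smul pt N Ω Ω' ε a (hval z))).symm }, fun z ↦ hval z, huniq,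
    fun z ↦ hker z (val z) (hval z), fun honto F ↦ ?_⟩
  obtain ⟨z, hz⟩ := honto F
  exact ⟨z, (huniq z F hz).symm⟩

end Generic

/-! ## §2 `Col⁺ ⊗ 𝒪` at `2` as one named `𝒪`-linear surjection with kernel `ann(E⁺_∞)` -/

section Two

open NumberField IsDedekindDomain WeierstrassCurve Literature.NumberTheory.EllipticCurves.Rank1Residual

variable (W : WeierstrassCurve ℚ) [W.IsElliptic] [W.IsGloballyMinimal]

/-- **`Col⁺ ⊗ 𝒪` at `p = 2` as a MAP** (functional model). For `W/ℚ` globally minimal with `GoodSS W 2`, `a₂ = 0`, cyclotomic `κ`, `v ∋ 2`: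
the plus Honda family `(g, d)` of `colemanPlus_coeff_two` ((L), (TR), (ND), `g` lifting the topological generator) and, for EVERY `𝒪` finite free
over `ℤ₂` and a domain, an `𝒪`-LINEAR map `col : Hom(E(ℚ_{2,∞}·ℚ_v), 𝒪) → 𝒪⟦T⟧` which (a) satisfies the plus congruences
`ω_{2m} ∣ Σ_{j<4^m} C(z(gʲd_{2m}))(X+1)^j + (−1)^m ω̃⁻_{2m}·col z`, (b) is PINNED by them (any plus value of `z` IS `col z` — U7), (c) is ONTO,
(d) has kernel `ann(E⁺_∞)`: `col z = 0 ↔ z` vanishes on every `signedLocalPoints κ ℚ_v W 1 n`. So `Hom(E(ℚ_{2,∞}·ℚ_v), 𝒪)/ann(E⁺_∞) ≅ Λ_𝒪`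
through one named map; the `𝒸` of STUB-PLAN rev 7 §3.2′ is `col ∘ loc₂`. [cite: Kobayashi2003, Thm. 6.2 (6.13) (p. 12), Prop. 8.12, Prop. 8.18–8.23]
[cite: Sprung2012, Thm. 2.2 (2′), Prop. 7.3, Def. 5.9] [cite: Sprung2017, Cor. 4.4] -/
theorem exists_colemanPlusHom_coeff_two (hss : GoodSS W 2) (ha : W.frobeniusTrace 2 = 0) (κ : ZpExtension ℚ 2) (hκ : κ.IsCyclotomic)
    (v : HeightOneSpectrum (𝓞 ℚ)) (hv : (2 : 𝓞 ℚ) ∈ v.asIdeal) :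
    ∃ (g : Field.absoluteGaloisGroup (v.adicCompletion ℚ)) (d : ℕ → localPoints W (v.adicCompletion ℚ))
      (hdA : ∀ m j, g ^ j • d m ∈ Sprung2012.localTowerPointsOfEmb κ (closureEmb (K := ℚ) (v.adicCompletion ℚ)) W),
      κ.IsTopGenerator (resGalOfEmb (closureEmb (K := ℚ) (v.adicCompletion ℚ)) g) ∧
      (∀ m, d m ∈ localLayerPointsOfEmb κ (closureEmb (K := ℚ) (v.adicCompletion ℚ)) W m) ∧
      (∀ m, localTraceOfEmb κ (closureEmb (K := ℚ) (v.adicCompletion ℚ)) W (m + 1) (m + 2) (d (m + 2)) = -d m) ∧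
      (∀ b ∈ localLayerPointsOfEmb κ (closureEmb (K := ℚ) (v.adicCompletion ℚ)) W 0, d 0 ≠ 2 • b) ∧
      ∀ (O : Type) [CommRing O] [IsDomain O] [Algebra ℤ_[2] O] [Module.Free ℤ_[2] O] [Module.Finite ℤ_[2] O],
        ∃ col : (Sprung2012.localTowerPointsOfEmb κ (closureEmb (K := ℚ) (v.adicCompletion ℚ)) W →+ O) →ₗ[O] PowerSeries O,
          (∀ (z : Sprung2012.localTowerPointsOfEmb κ (closureEmb (K := ℚ) (v.adicCompletion ℚ)) W →+ O) (m : ℕ),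
            (((cyclotomicOmega 2 (2 * m)).map (Int.castRingHom O) : O[X]) : PowerSeries O) ∣
              ((∑ j ∈ range (2 ^ (2 * m)), C (z ⟨g ^ j • d (2 * m), hdA (2 * m) j⟩) * (X + 1) ^ j : O[X]) : PowerSeries O) +
                (-1 : PowerSeries O) ^ m * (((cyclotomicOmegaMinus 2 (2 * m)).map (Int.castRingHom O) : O[X]) : PowerSeries O) * col z) ∧
          (∀ (z : Sprung2012.localTowerPointsOfEmb κ (closureEmb (K := ℚ) (v.adicCompletion ℚ)) W →+ O) (L : PowerSeries O),
            (∀ m : ℕ, (((cyclotomicOmega 2 (2 * m)).map (Int.castRingHom O) : O[X]) : PowerSeries O) ∣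
              ((∑ j ∈ range (2 ^ (2 * m)), C (z ⟨g ^ j • d (2 * m), hdA (2 * m) j⟩) * (X + 1) ^ j : O[X]) : PowerSeries O) +
                (-1 : PowerSeries O) ^ m * (((cyclotomicOmegaMinus 2 (2 * m)).map (Int.castRingHom O) : O[X]) : PowerSeries O) * L) →
            L = col z) ∧
          Surjective col ∧
          (∀ z : Sprung2012.localTowerPointsOfEmb κ (closureEmb (K := ℚ) (v.adicCompletion ℚ)) W →+ O,
            col z = 0 ↔ ∀ (n : ℕ) (x : localPoints W (v.adicCompletion ℚ))
              (hx : x ∈ signedLocalPoints κ (v.adicCompletion ℚ) W 1 n),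
              z ⟨x, Sprung2012.localLayerPointsOfEmb_le_localTowerPointsOfEmb κ _ W n (signedLocalPointsOfEmb_le κ _ W 1 n hx)⟩ = 0) := by
  obtain ⟨g, d, hdA, hg, hd, htr, hND, hO⟩ := colemanPlus_coeff_two W hss ha κ hκ v hv
  refine ⟨g, d, hdA, hg, hd, htr, hND, fun O _ _ _ _ _ ↦ ?_⟩
  obtain ⟨hex, honto, hker⟩ := hO O
  -- the generic packaging with `pt m j := gʲ·d_{2m}`, `N m := 4^m`, `Ω := ω_{2m}`, `Ω' := ω̃⁻_{2m}`, `ε m := (−1)^m`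
  obtain ⟨col, hcong, hpin, hkerc, hsurj⟩ := exists_linearMap_of_plusCongr
    (fun m j ↦ (⟨g ^ j • d (2 * m), hdA (2 * m) j⟩ : Sprung2012.localTowerPointsOfEmb κ (closureEmb (K := ℚ) (v.adicCompletion ℚ)) W))
    (fun m ↦ 2 ^ (2 * m)) (fun m ↦ (((cyclotomicOmega 2 (2 * m)).map (Int.castRingHom O) : O[X]) : PowerSeries O))
    (fun m ↦ (((cyclotomicOmegaMinus 2 (2 * m)).map (Int.castRingHom O) : O[X]) : PowerSeries O)) (fun m ↦ (-1 : PowerSeries O) ^ m)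
    (fun z ↦ ∀ (n : ℕ) (x : localPoints W (v.adicCompletion ℚ)) (hx : x ∈ signedLocalPoints κ (v.adicCompletion ℚ) W 1 n),
      z ⟨x, Sprung2012.localLayerPointsOfEmb_le_localTowerPointsOfEmb κ _ W n (signedLocalPointsOfEmb_le κ _ W 1 n hx)⟩ = 0)
    (fun _ _ _ ↦ rfl) hex hker
  exact ⟨col, hcong, hpin, hsurj honto, hkerc⟩

end Two

end Summit.BirchSwinnertonDyer.BirchSwinnertonDyer.Theorems.SignedColemanImage

end
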